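import Mathlib.Analysis.Meromorphic.TrailingCoefficient
import Mathlib.Analysis.Complex.ReImTopology
import Summits.HodgeConjecture.HodgeConjecture.Theorems.F0P2wThetaPoleUnknownPlaces
import HarnessLib

/-!
# L7 «POLE-ORDER JUNCTION»: the order of a meromorphic function from a ONE-SIDED limit, and the W4 pole of
# ROAD-W read in the house currency `meromorphicOrderAt g s₀ = -1` of a meromorphic continuation `g`

Cell `pub/hodgecm-mathlib`, crux H413 = `stmt-HodgeConjecture-24833`, P2 toe-hold L7 of ROAD-W v1 §2 (W4 → W5 junction).
THEOREMS ONLY (no definition, no instance, no named fact, no `sorry`); lane `--kind proof --supports stmt-HodgeConjecture-24833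
--as helper`; touches no registry and no served Line; count-neutral.  HONEST LABEL: HC_CM is proved only modulo the printed
citations until rung 0 closes; this file proves nothing about them.

WHY.  The W4 «POLE» chain (★ L2 `F0P2wThetaShapeOfWeight` · L3 `PrimeSumsHigherDegreeHalfPlane` · L4
`ThinPlacesEulerProductHalfPlane` · L5′ `PartialEulerProductSplitting` · (A) `F0P2wPartialDedekindZetaPole` · (B)
`F0P2wThetaPartialLPole` · L6-θ `F0P2wThetaPoleUnknownPlaces`) exhibits the pole of the partial standard `L`-function
`L^S(s, α)` of a theta-shape Satake family FROM THE EULER SIDE: `(s − 3/2) · L^S(s, α) → r ≠ 0` as `s → 3/2` within the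
half-plane of convergence `re s > 3/2`.  A `MeromorphicAt`-typed pole ⇒ theta letter [Liu2021, App. B §B.2, Thm. B.4
(1)(a) p. 98] is about the MEROMORPHIC CONTINUATION of the `L`-function (house currency: ★
`Literature.NumberTheory.GaloisRepresentations.LFunction.HasMeromorphicContinuation f = ∃ g, Meromorphic g ∧ ∀ s, 1 < re s → g s = f s`,
and «order `m` at `s₀`» = `meromorphicOrderAt g s₀ = m`, as in ★ `Literature/Barriers/RiemannHypothesis/NoRealWeilCohomology`
and ★ `Literature/NumberTheory/Automorphic/GodementJacquetPartialL`).  This file is the glue: the Euler-side one-sided residue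
limit forces `meromorphicOrderAt g (3/2) = -1` for EVERY meromorphic continuation `g` (§3–§4), by a folklore refinement of
the textbook pole-order criterion (§1–§2) that Mathlib states only for the full punctured neighbourhood.

§1 (generic: any nontrivially normed field `𝕜`, any normed `𝕜`-space `E`).  The criterion «`f` has a pole of
order `m` at `a` iff `lim_{z → a} (z − a)^m f(z)` exists and is non-zero; at a simple pole the limit is the residue»
(Conway, *Functions of One Complex Variable I*, Ch. V §1 Thm. 1.2, Prop. 1.4, Def. 1.6, Cor. 1.18 (b); §2 Prop. 2.4) is in
Mathlib along `𝓝[≠] x` (`tendsto_ne_zero_iff_meromorphicOrderAt_eq_zero`, `tendsto_cobounded_iff_meromorphicOrderAt_neg`,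
`tendsto_zero_iff_meromorphicOrderAt_pos`, `MeromorphicAt.tendsto_nhds_meromorphicTrailingCoeffAt`).  Refinement proved
here: for `f` MEROMORPHIC at `x` the order is determined by the behaviour along ANY non-trivial filter `l ≤ 𝓝[≠] x`
(a meromorphic germ tends to `∞`, to a non-zero vector, or to `0` along `𝓝[≠] x` according to the sign of its order, hence
along `l`, and the three behaviours exclude each other on a non-trivial filter):
`meromorphicOrderAt_eq_zero_of_tendsto`, `meromorphicOrderAt_eq_of_tendsto_zpow_smul` (order `n` from
`(z − x)^{−n} • f z → c ≠ 0`), `meromorphicOrderAt_eq_neg_one_of_tendsto_sub_smul` ∕ `…_sub_mul` (simple pole), the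
converse `tendsto_zpow_smul_of_meromorphicOrderAt_eq` along every such `l` (limit = Mathlib's
`meromorphicTrailingCoeffAt f x ≠ 0`) and the iff `meromorphicOrderAt_eq_iff_tendsto_zpow_smul`.
§2 (`ℂ`).  The right half-plane filter `𝓝[{s | re x < re s}] x` is such an `l` (`nhdsWithin_re_lt_le_nhdsNE`; non-trivial
by ★ `Literature.NumberTheory.Automorphic.nhdsWithin_setOf_lt_re_neBot`, re-derived inline); `meromorphicOrderAt_eq_neg_one_of_eventuallyEq_re_lt` ∕ `…_of_eqOn_re_lt` (a function
meromorphic at `s₀` agreeing to the right of `s₀` with an `L` such that `(s − s₀) L s → c ≠ 0` there has a simple pole);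
`meromorphicOrderAt_eq_of_eqOn_re_lt` (identity principle: two functions meromorphic on `ℂ` agreeing on a right half-plane
have the same order EVERYWHERE — the order of «the» continuation is well defined; cf. the private lemma of ★
`NoRealWeilCohomology` for `re s > 1`).
§3 (`HasMeromorphicContinuation` currency).  `forall_meromorphicOrderAt_eq_neg_one_of_tendsto` ∕
`exists_meromorphicOrderAt_eq_neg_one_of_tendsto`: for `f` with `(s − s₀) f s → c ≠ 0` within `re s > re s₀`, `1 ≤ re s₀`,
EVERY meromorphic `g` agreeing with `f` on `re s > 1` has `meromorphicOrderAt g s₀ = -1` (and one exists under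
`HasMeromorphicContinuation f`).
§4 (BY NAME).  `meromorphicOrderAt_eq_neg_one_of_thetaShape` ⟸ ★ (B) `F0P2wThetaPartialLPole.tendsto_sub_mul_thetaPartialL`
(thin `S`); `meromorphicOrderAt_eq_neg_one_of_thetaShape_degOne` ⟸ ★ L6-θ
`F0P2wThetaPoleUnknownPlaces.exists_differentiableOn_sub_mul_partialStandardL_eq_of_thetaShape_degOne` (finite `S₀`,
unknown places of degree `≥ 2` with `θ < 1`); both also in the `∀ g, Meromorphic g → (∀ s, 1 < re s → g s = L^S(s, α)) → …`
form in which a witness of `HasMeromorphicContinuation (partialStandardL S α)` is consumed.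

What is NOT here: the meromorphic continuation of `L^S(s, π × μ)` itself (doubling ∕ Langlands–Shahidi — W5, PRINT
[Liu2021, App. B §B.2–B.3 pp. 96–104]) and any claim that the pole is Liu's (identity of `L`-functions is W5's bookkeeping).

## References
* J. B. Conway, *Functions of One Complex Variable I*, GTM 11, Springer 1978, Ch. V §1 (Thm. 1.2, Prop. 1.4, Def. 1.6,
  Cor. 1.18 (b)), §2 (Prop. 2.4); Ch. IV §3 (Thm. 3.7, identity theorem). [folklore]
* Y. Liu, *Fourier–Jacobi cycles and arithmetic relative trace formula* (with an appendix by C. Li and Y. Zhu), Camb. J.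
  Math. 9 (2021) no. 1, 1–147 (arXiv 2102.11518), App. B §B.2 Thm. B.4 (1)(a) p. 98 (the consumer's pole hypothesis; NOT
  formalised here). [Liu2021]
-/

set_option autoImplicit false
set_option linter.dupNamespace false -- the mandated namespace repeats `HodgeConjecture.HodgeConjecture`

noncomputable section

open Filter Topology Bornology Complex NumberField IsDedekindDomain
open Literature.NumberTheory.Automorphic
open Summit.HodgeConjecture.HodgeConjecture.Cruxes.H413

namespace Summit.HodgeConjecture.HodgeConjecture.Cruxes.H413.F0P2wPoleOrderJunction

/-! ## §1 The pole-order criterion along a sub-filter (generic) -/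

section General

variable {𝕜 : Type*} [NontriviallyNormedField 𝕜] {E : Type*} [NormedAddCommGroup E] [NormedSpace 𝕜 E]
  {f : 𝕜 → E} {x : 𝕜} {l : Filter 𝕜} {c : E}

/-- **Order `0` from a one-sided limit.**  If `f` tends to a NON-ZERO vector along some non-trivial filter
`l ≤ 𝓝[≠] x`, then `meromorphicOrderAt f x = 0`.  (A meromorphic germ of negative order tends to `∞` along `𝓝[≠] x`,
one of positive order to `0`; both are incompatible with a non-zero finite limit along `l`.  No meromorphy hypothesis is
needed: Mathlib's junk value of the order of a non-meromorphic germ is `0`.)  Cf. Conway V §1 Thm. 1.2, Def. 1.6.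
[folklore] -/
theorem meromorphicOrderAt_eq_zero_of_tendsto (hl : l ≤ 𝓝[≠] x) [l.NeBot] (hc : c ≠ 0)
    (h : Tendsto f l (𝓝 c)) : meromorphicOrderAt f x = 0 := by
  rcases lt_trichotomy (meromorphicOrderAt f x) 0 with ho | ho | ho
  · exact absurd (tendsto_norm_atTop_iff_cobounded.2 ((tendsto_cobounded_of_meromorphicOrderAt_neg ho).mono_left hl))
      (not_tendsto_atTop_of_tendsto_nhds h.norm)
  · exact ho
  · exact absurd (tendsto_nhds_unique h ((tendsto_zero_of_meromorphicOrderAt_pos ho).mono_left hl)) hc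

/-- The germ `z ↦ (z - x) ^ m • f z` is meromorphic at `x` when `f` is. [folklore] -/
theorem meromorphicAt_zpow_sub_smul (hf : MeromorphicAt f x) (m : ℤ) :
    MeromorphicAt (fun z => (z - x) ^ m • f z) x :=
  ((MeromorphicAt.id x).sub (MeromorphicAt.const x x)).zpow m |>.smul hf

/-- The order of `z ↦ (z - x) ^ m • f z` at `x` is `m + meromorphicOrderAt f x` (Mathlib `meromorphicOrderAt_smul` and
`meromorphicOrderAt_zpow_id_sub_const`, repackaged in `fun` form). [folklore] -/
theorem meromorphicOrderAt_zpow_sub_smul (hf : MeromorphicAt f x) (m : ℤ) :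
    meromorphicOrderAt (fun z => (z - x) ^ m • f z) x = (m : WithTop ℤ) + meromorphicOrderAt f x := by
  have h1 : MeromorphicAt (fun z : 𝕜 => (z - x) ^ m) x := ((MeromorphicAt.id x).sub (MeromorphicAt.const x x)).zpow m
  have h2 : meromorphicOrderAt ((fun z : 𝕜 => (z - x) ^ m) • f) x = (m : WithTop ℤ) + meromorphicOrderAt f x := by
    rw [meromorphicOrderAt_smul h1 hf]
    congr 1
    exact meromorphicOrderAt_zpow_id_sub_const
  have h3 : (fun z => (z - x) ^ m • f z) = ((fun z : 𝕜 => (z - x) ^ m) • f) := rfl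
  rw [h3]
  exact h2

/-- **Order `n` from a one-sided limit** (pole-order criterion along a sub-filter).  If `f` is meromorphic at `x` and
`(z − x)^{−n} • f z → c ≠ 0` along some non-trivial filter `l ≤ 𝓝[≠] x`, then `meromorphicOrderAt f x = n`.
Cf. Conway V §1 Def. 1.6, Cor. 1.18 (b) (there with the full limit `z → a`). [folklore] -/
theorem meromorphicOrderAt_eq_of_tendsto_zpow_smul (hf : MeromorphicAt f x) (hl : l ≤ 𝓝[≠] x) [l.NeBot] {n : ℤ}
    (hc : c ≠ 0) (h : Tendsto (fun z => (z - x) ^ (-n) • f z) l (𝓝 c)) : meromorphicOrderAt f x = n := by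
  have h0 := meromorphicOrderAt_eq_zero_of_tendsto hl hc h
  rw [meromorphicOrderAt_zpow_sub_smul hf (-n)] at h0
  cases ho : meromorphicOrderAt f x with
  | top => simp [ho] at h0
  | coe m =>
    rw [ho, ← WithTop.coe_add, ← WithTop.coe_zero, WithTop.coe_eq_coe] at h0
    rw [WithTop.coe_eq_coe]
    omega

/-- **Simple pole from a one-sided residue limit** (vector-valued).  If `f` is meromorphic at `x` and
`(z − x) • f z → c ≠ 0` along some non-trivial filter `l ≤ 𝓝[≠] x`, then `f` has a simple pole at `x`:
`meromorphicOrderAt f x = -1`.  Cf. Conway V §2 Prop. 2.4 (`Res = lim (z − a) f(z)` at a simple pole). [folklore] -/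
theorem meromorphicOrderAt_eq_neg_one_of_tendsto_sub_smul (hf : MeromorphicAt f x) (hl : l ≤ 𝓝[≠] x) [l.NeBot]
    (hc : c ≠ 0) (h : Tendsto (fun z => (z - x) • f z) l (𝓝 c)) : meromorphicOrderAt f x = -1 :=
  meromorphicOrderAt_eq_of_tendsto_zpow_smul hf hl hc (by simpa only [neg_neg, zpow_one] using h)

/-- **Simple pole from a one-sided residue limit** (scalar-valued, `HMul` form).  If `f : 𝕜 → 𝕜` is meromorphic at `x`
and `(z − x) * f z → c ≠ 0` along some non-trivial filter `l ≤ 𝓝[≠] x`, then `meromorphicOrderAt f x = -1`.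
Cf. Conway V §2 Prop. 2.4. [folklore] -/
theorem meromorphicOrderAt_eq_neg_one_of_tendsto_sub_mul {f : 𝕜 → 𝕜} {c : 𝕜} (hf : MeromorphicAt f x)
    (hl : l ≤ 𝓝[≠] x) [l.NeBot] (hc : c ≠ 0) (h : Tendsto (fun z => (z - x) * f z) l (𝓝 c)) :
    meromorphicOrderAt f x = -1 :=
  meromorphicOrderAt_eq_neg_one_of_tendsto_sub_smul hf hl hc (by simpa only [smul_eq_mul] using h)

/-- **Converse: the one-sided limit exists at the order.**  If `f` is meromorphic at `x` of finite order `n`, then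
along EVERY filter `l ≤ 𝓝[≠] x` the function `(z − x)^{−n} • f z` tends to Mathlib's trailing coefficient
`meromorphicTrailingCoeffAt f x`, which is non-zero.  Cf. Conway V §1 (1.7), §2 Prop. 2.4. [folklore] -/
theorem tendsto_zpow_smul_of_meromorphicOrderAt_eq (hf : MeromorphicAt f x) {n : ℤ} (ho : meromorphicOrderAt f x = n)
    (hl : l ≤ 𝓝[≠] x) :
    meromorphicTrailingCoeffAt f x ≠ 0 ∧
      Tendsto (fun z => (z - x) ^ (-n) • f z) l (𝓝 (meromorphicTrailingCoeffAt f x)) := by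
  refine ⟨hf.meromorphicTrailingCoeffAt_ne_zero (by simp [ho]), ?_⟩
  have h := hf.tendsto_nhds_meromorphicTrailingCoeffAt
  rw [ho, WithTop.untop₀_coe] at h
  exact h.mono_left hl

/-- **The pole-order criterion along a sub-filter (iff).**  For `f` meromorphic at `x` and any non-trivial filter
`l ≤ 𝓝[≠] x`: `meromorphicOrderAt f x = n` iff `(z − x)^{−n} • f z` has a NON-ZERO limit along `l`.
Cf. Conway V §1 Def. 1.6, Cor. 1.18 (b). [folklore] -/
theorem meromorphicOrderAt_eq_iff_tendsto_zpow_smul (hf : MeromorphicAt f x) (hl : l ≤ 𝓝[≠] x) [l.NeBot] (n : ℤ) :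
    meromorphicOrderAt f x = n ↔ ∃ c : E, c ≠ 0 ∧ Tendsto (fun z => (z - x) ^ (-n) • f z) l (𝓝 c) :=
  ⟨fun ho => ⟨_, tendsto_zpow_smul_of_meromorphicOrderAt_eq hf ho hl⟩,
    fun ⟨_, hc, h⟩ => meromorphicOrderAt_eq_of_tendsto_zpow_smul hf hl hc h⟩

end General

/-! ## §2 The right half-plane filter on `ℂ`; the identity principle for the order -/

section HalfPlane

/-- The open right half-plane `{s | re x < re s}` misses `x`, so `𝓝[{s | x.re < s.re}] x ≤ 𝓝[≠] x`. [folklore] -/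
theorem nhdsWithin_re_lt_le_nhdsNE (x : ℂ) : 𝓝[{s : ℂ | x.re < s.re}] x ≤ 𝓝[≠] x :=
  nhdsWithin_mono x fun s hs hsx => by
    simp only [Set.mem_setOf_eq] at hs
    rw [hsx] at hs
    exact lt_irrefl _ hs

/-- **Simple pole from a one-sided residue limit of ANOTHER function** (the `L`-function form).  Let `Λ` be meromorphic
at `s₀ ∈ ℂ` and agree, on `re s > re s₀` near `s₀`, with a function `L` (e.g. an Euler product, convergent only there)
such that `(s − s₀) · L s → c ≠ 0` as `s → s₀` within `re s > re s₀`.  Then `Λ` has a simple pole at `s₀`: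
`meromorphicOrderAt Λ s₀ = -1`.  Cf. Conway V §2 Prop. 2.4. [folklore] -/
theorem meromorphicOrderAt_eq_neg_one_of_eventuallyEq_re_lt {Λ L : ℂ → ℂ} {s₀ c : ℂ} (hΛ : MeromorphicAt Λ s₀)
    (hagree : Λ =ᶠ[𝓝[{s : ℂ | s₀.re < s.re}] s₀] L)
    (hlim : Tendsto (fun s => (s - s₀) * L s) (𝓝[{s : ℂ | s₀.re < s.re}] s₀) (𝓝 c)) (hc : c ≠ 0) :
    meromorphicOrderAt Λ s₀ = -1 := by
  -- `s₀` adheres to the open right half-plane (Mathlib `Complex.closure_setOf_lt_re`), so the filter is non-trivial;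
  -- this is ★ `Literature.NumberTheory.Automorphic.nhdsWithin_setOf_lt_re_neBot` (ArthurClozelCuspidalDescentIsobaricFamilies),
  -- re-derived inline to keep this file's import cone at Mathlib + the W4 chain.
  haveI : (𝓝[{s : ℂ | s₀.re < s.re}] s₀).NeBot := by
    rw [← mem_closure_iff_nhdsWithin_neBot, Complex.closure_setOf_lt_re]
    exact le_refl s₀.re
  refine meromorphicOrderAt_eq_neg_one_of_tendsto_sub_mul hΛ (nhdsWithin_re_lt_le_nhdsNE s₀) hc ?_
  exact hlim.congr' (hagree.mono fun s hs => by simp only [hs])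

/-- Pointwise-agreement form of `meromorphicOrderAt_eq_neg_one_of_eventuallyEq_re_lt`: if `Λ` is meromorphic at `s₀`,
`Λ s = L s` for all `s` with `re s > σ` for some `σ ≤ re s₀`, and `(s − s₀) · L s → c ≠ 0` within `re s > re s₀`,
then `meromorphicOrderAt Λ s₀ = -1`. [folklore] -/
theorem meromorphicOrderAt_eq_neg_one_of_eqOn_re_lt {Λ L : ℂ → ℂ} {s₀ c : ℂ} {σ : ℝ} (hΛ : MeromorphicAt Λ s₀)
    (hσ : σ ≤ s₀.re) (hagree : ∀ s : ℂ, σ < s.re → Λ s = L s)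
    (hlim : Tendsto (fun s => (s - s₀) * L s) (𝓝[{s : ℂ | s₀.re < s.re}] s₀) (𝓝 c)) (hc : c ≠ 0) :
    meromorphicOrderAt Λ s₀ = -1 :=
  meromorphicOrderAt_eq_neg_one_of_eventuallyEq_re_lt hΛ
    (eventually_nhdsWithin_of_forall fun s hs => hagree s (lt_of_le_of_lt hσ hs)) hlim hc

/-- **Identity principle for the order.**  Two functions meromorphic on all of `ℂ` that agree on a right half-plane
`re s > σ` have the same `meromorphicOrderAt` at EVERY point: `g₁ − g₂` vanishes near `σ + 1`, hence (isolated zeros of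
a meromorphic function on the connected `ℂ`, Mathlib `MeromorphicOn.meromorphicOrderAt_ne_top_of_isPreconnected`) on a
punctured neighbourhood of every point.  So «the order at `s₀` of THE meromorphic continuation of `L`» does not depend
on the continuation.  Cf. Conway IV §3 Thm. 3.7 (identity theorem). [folklore] -/
theorem meromorphicOrderAt_eq_of_eqOn_re_lt {g₁ g₂ : ℂ → ℂ} {σ : ℝ} (hg₁ : Meromorphic g₁) (hg₂ : Meromorphic g₂)
    (h : ∀ s : ℂ, σ < s.re → g₁ s = g₂ s) (z : ℂ) :
    meromorphicOrderAt g₁ z = meromorphicOrderAt g₂ z := by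
  have hsub : Meromorphic (g₁ - g₂) := hg₁.sub hg₂
  -- `g₁ - g₂` vanishes identically near `σ + 1`
  have h1 : meromorphicOrderAt (g₁ - g₂) ((σ + 1 : ℝ) : ℂ) = ⊤ := by
    rw [meromorphicOrderAt_eq_top_iff]
    have hopen : IsOpen {s : ℂ | σ < s.re} := isOpen_lt continuous_const Complex.continuous_re
    have hmem : ((σ + 1 : ℝ) : ℂ) ∈ {s : ℂ | σ < s.re} := by
      simp only [Set.mem_setOf_eq, Complex.ofReal_re]
      linarith
    filter_upwards [nhdsWithin_le_nhds (hopen.mem_nhds hmem)] with s hs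
    simp [Pi.sub_apply, h s hs]
  -- hence near every point (`ℂ` is connected)
  have hall : ∀ w : ℂ, meromorphicOrderAt (g₁ - g₂) w = ⊤ := fun w => by
    by_contra hw
    exact (hsub.meromorphicOn (s := Set.univ)).meromorphicOrderAt_ne_top_of_isPreconnected isPreconnected_univ
      (Set.mem_univ w) (Set.mem_univ _) hw h1
  refine meromorphicOrderAt_congr ?_
  filter_upwards [meromorphicOrderAt_eq_top_iff.1 (hall z)] with s hs
  simpa [sub_eq_zero] using hs

end HalfPlane

/-! ## §3 The `HasMeromorphicContinuation` currency (agreement on `re s > 1`) -/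

section Continuation

variable {f : ℂ → ℂ} {s₀ c : ℂ}

/-- **Every meromorphic continuation has a simple pole.**  If `(s − s₀) · f s → c ≠ 0` as `s → s₀` within
`re s > re s₀`, where `1 ≤ re s₀`, then EVERY function `g` meromorphic on `ℂ` with `g = f` on `re s > 1` — i.e. every
witness of ★ `LFunction.HasMeromorphicContinuation f` — satisfies `meromorphicOrderAt g s₀ = -1`. [folklore] -/
theorem forall_meromorphicOrderAt_eq_neg_one_of_tendsto (hs₀ : 1 ≤ s₀.re)
    (hlim : Tendsto (fun s => (s - s₀) * f s) (𝓝[{s : ℂ | s₀.re < s.re}] s₀) (𝓝 c)) (hc : c ≠ 0) :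
    ∀ g : ℂ → ℂ, Meromorphic g → (∀ s : ℂ, 1 < s.re → g s = f s) → meromorphicOrderAt g s₀ = -1 :=
  fun _g hg hgf => meromorphicOrderAt_eq_neg_one_of_eqOn_re_lt (hg s₀) hs₀ hgf hlim hc

/-- Under ★ `LFunction.HasMeromorphicContinuation f` and the one-sided residue limit at `s₀` (`1 ≤ re s₀`), SOME function
meromorphic on `ℂ` agrees with `f` on `re s > 1` and has a simple pole at `s₀` (and by
`forall_meromorphicOrderAt_eq_neg_one_of_tendsto` ∕ `meromorphicOrderAt_eq_of_eqOn_re_lt` every such function does).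
[folklore] -/
theorem exists_meromorphicOrderAt_eq_neg_one_of_tendsto
    (hf : Literature.NumberTheory.GaloisRepresentations.LFunction.HasMeromorphicContinuation f) (hs₀ : 1 ≤ s₀.re)
    (hlim : Tendsto (fun s => (s - s₀) * f s) (𝓝[{s : ℂ | s₀.re < s.re}] s₀) (𝓝 c)) (hc : c ≠ 0) :
    ∃ g : ℂ → ℂ, Meromorphic g ∧ (∀ s : ℂ, 1 < s.re → g s = f s) ∧ meromorphicOrderAt g s₀ = -1 := by
  obtain ⟨g, hg, hgf⟩ := hf
  exact ⟨g, hg, hgf, forall_meromorphicOrderAt_eq_neg_one_of_tendsto hs₀ hlim hc g hg hgf⟩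

end Continuation

/-! ## §4 The W4 pole BY NAME: theta-shape partial `L`-functions have `meromorphicOrderAt g (3/2) = -1` -/

section ThetaShape

variable {K : Type} [Field K] [NumberField K]

/-- `(3/2 : ℂ).re = 3/2`. [folklore] -/
theorem re_three_halves : ((3 / 2 : ℂ)).re = 3 / 2 := by norm_num

/-- **W4 POLE (B) in the house currency** (thin `S`).  Under the hypotheses of ★ (B)
`F0P2wThetaPartialLPole.tendsto_sub_mul_thetaPartialL` — `S` thin at some `σ₀ ∈ [1/2, 1)` and `α v = {√q_v, (√q_v)⁻¹, c v}`
with `‖c v‖ ≤ 1` off `S` — every function `g` meromorphic at `3/2` that agrees with `L^S(s, α) = partialStandardL S α s`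
on a half-plane `re s > σ` with `σ ≤ 3/2` has a SIMPLE POLE at `3/2`: `meromorphicOrderAt g (3/2) = -1`.
[cite: Liu2021, App. B §B.2, Thm. B.4 (1)(a) p. 98 (the pole hypothesis; `n = 3`, `s₀ = n/2` as in Cor. B.6)] -/
theorem meromorphicOrderAt_eq_neg_one_of_thetaShape {S : Set (HeightOneSpectrum (𝓞 K))} {α : SatakeFamily K}
    {c : HeightOneSpectrum (𝓞 K) → ℂ} {σ₀ : ℝ}
    (hS : Summable fun v : S => ((v : HeightOneSpectrum (𝓞 K)).residueCard : ℝ) ^ (-σ₀))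
    (hσ₀ : 1 / 2 ≤ σ₀) (hσ₁ : σ₀ < 1) (hc : ∀ v, v ∉ S → ‖c v‖ ≤ 1)
    (hα : ∀ v, v ∉ S → α v = {((Real.sqrt v.residueCard : ℝ) : ℂ), ((Real.sqrt v.residueCard : ℝ) : ℂ)⁻¹, c v})
    {g : ℂ → ℂ} (hg : MeromorphicAt g (3 / 2)) {σ : ℝ} (hσ : σ ≤ 3 / 2)
    (hagree : ∀ s : ℂ, σ < s.re → g s = partialStandardL S α s) :
    meromorphicOrderAt g (3 / 2) = -1 := by
  obtain ⟨r, hr, hlim⟩ := F0P2wThetaPartialLPole.tendsto_sub_mul_thetaPartialL hS hσ₀ hσ₁ hc hα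
  have hlim' : Tendsto (fun s : ℂ => (s - 3 / 2) * partialStandardL S α s)
      (𝓝[{s : ℂ | ((3 / 2 : ℂ)).re < s.re}] (3 / 2)) (𝓝 r) := by
    rw [re_three_halves]
    exact hlim
  exact meromorphicOrderAt_eq_neg_one_of_eqOn_re_lt hg (by rw [re_three_halves]; exact hσ) hagree hlim' hr

/-- **W4 POLE (B), `HasMeromorphicContinuation` form**: under the hypotheses of ★ (B) `tendsto_sub_mul_thetaPartialL`,
EVERY `g` meromorphic on `ℂ` with `g s = L^S(s, α)` for `re s > 1` (a witness of
`LFunction.HasMeromorphicContinuation (partialStandardL S α)`) has `meromorphicOrderAt g (3/2) = -1`.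
[cite: Liu2021, App. B §B.2, Thm. B.4 (1)(a) p. 98] -/
theorem forall_meromorphicOrderAt_eq_neg_one_of_thetaShape {S : Set (HeightOneSpectrum (𝓞 K))} {α : SatakeFamily K}
    {c : HeightOneSpectrum (𝓞 K) → ℂ} {σ₀ : ℝ}
    (hS : Summable fun v : S => ((v : HeightOneSpectrum (𝓞 K)).residueCard : ℝ) ^ (-σ₀))
    (hσ₀ : 1 / 2 ≤ σ₀) (hσ₁ : σ₀ < 1) (hc : ∀ v, v ∉ S → ‖c v‖ ≤ 1)
    (hα : ∀ v, v ∉ S → α v = {((Real.sqrt v.residueCard : ℝ) : ℂ), ((Real.sqrt v.residueCard : ℝ) : ℂ)⁻¹, c v}) :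
    ∀ g : ℂ → ℂ, Meromorphic g → (∀ s : ℂ, 1 < s.re → g s = partialStandardL S α s) →
      meromorphicOrderAt g (3 / 2) = -1 :=
  fun _g hg hagree => meromorphicOrderAt_eq_neg_one_of_thetaShape hS hσ₀ hσ₁ hc hα (hg _) (by norm_num) hagree

/-- **W4 POLE with unknown places (L6-θ) in the house currency.**  Under the hypotheses of ★ L6-θ
`F0P2wThetaPoleUnknownPlaces.exists_differentiableOn_sub_mul_partialStandardL_eq_of_thetaShape_degOne` — finite `S₀`, theta
shape at the degree-one places off `S₀`, only `#(α v) ≤ n` and `‖a‖ ≤ q_v^θ` with `θ < 1` at the other places off `S₀` —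
every function `g` meromorphic at `3/2` agreeing with `L^{S₀}(s, α)` on a half-plane `re s > σ`, `σ ≤ 3/2`, has a SIMPLE
POLE at `3/2`: `meromorphicOrderAt g (3/2) = -1`. [cite: Liu2021, App. B §B.2, Thm. B.4 (1)(a) p. 98] -/
theorem meromorphicOrderAt_eq_neg_one_of_thetaShape_degOne {S₀ : Set (HeightOneSpectrum (𝓞 K))} (hS₀ : S₀.Finite)
    {α : SatakeFamily K} {c : HeightOneSpectrum (𝓞 K) → ℂ} {θ : ℝ} (hθ : θ < 1) {n : ℕ}
    (hc : ∀ v, v ∉ S₀ → (Ideal.absNorm v.asIdeal).Prime → ‖c v‖ ≤ 1)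
    (hα : ∀ v, v ∉ S₀ → (Ideal.absNorm v.asIdeal).Prime →
      α v = {((Real.sqrt v.residueCard : ℝ) : ℂ), ((Real.sqrt v.residueCard : ℝ) : ℂ)⁻¹, c v})
    (hcard : ∀ v, v ∉ S₀ → ¬ (Ideal.absNorm v.asIdeal).Prime → Multiset.card (α v) ≤ n)
    (hαθ : ∀ v, v ∉ S₀ → ¬ (Ideal.absNorm v.asIdeal).Prime → ∀ a ∈ α v, ‖a‖ ≤ (v.residueCard : ℝ) ^ θ)
    {g : ℂ → ℂ} (hg : MeromorphicAt g (3 / 2)) {σ : ℝ} (hσ : σ ≤ 3 / 2)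
    (hagree : ∀ s : ℂ, σ < s.re → g s = partialStandardL S₀ α s) :
    meromorphicOrderAt g (3 / 2) = -1 := by
  obtain ⟨G, -, hG0, -, hlim⟩ :=
    F0P2wThetaPoleUnknownPlaces.exists_differentiableOn_sub_mul_partialStandardL_eq_of_thetaShape_degOne
      hS₀ hθ hc hα hcard hαθ
  have hlim' : Tendsto (fun s : ℂ => (s - 3 / 2) * partialStandardL S₀ α s)
      (𝓝[{s : ℂ | ((3 / 2 : ℂ)).re < s.re}] (3 / 2)) (𝓝 (G (3 / 2))) := by
    rw [re_three_halves]
    exact hlim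
  exact meromorphicOrderAt_eq_neg_one_of_eqOn_re_lt hg (by rw [re_three_halves]; exact hσ) hagree hlim' hG0

/-- **W4 POLE with unknown places (L6-θ), `HasMeromorphicContinuation` form**: under the hypotheses of ★ L6-θ, EVERY `g`
meromorphic on `ℂ` with `g s = L^{S₀}(s, α)` for `re s > 1` has `meromorphicOrderAt g (3/2) = -1`.
[cite: Liu2021, App. B §B.2, Thm. B.4 (1)(a) p. 98] -/
theorem forall_meromorphicOrderAt_eq_neg_one_of_thetaShape_degOne {S₀ : Set (HeightOneSpectrum (𝓞 K))}
    (hS₀ : S₀.Finite) {α : SatakeFamily K} {c : HeightOneSpectrum (𝓞 K) → ℂ} {θ : ℝ} (hθ : θ < 1) {n : ℕ}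
    (hc : ∀ v, v ∉ S₀ → (Ideal.absNorm v.asIdeal).Prime → ‖c v‖ ≤ 1)
    (hα : ∀ v, v ∉ S₀ → (Ideal.absNorm v.asIdeal).Prime →
      α v = {((Real.sqrt v.residueCard : ℝ) : ℂ), ((Real.sqrt v.residueCard : ℝ) : ℂ)⁻¹, c v})
    (hcard : ∀ v, v ∉ S₀ → ¬ (Ideal.absNorm v.asIdeal).Prime → Multiset.card (α v) ≤ n)
    (hαθ : ∀ v, v ∉ S₀ → ¬ (Ideal.absNorm v.asIdeal).Prime → ∀ a ∈ α v, ‖a‖ ≤ (v.residueCard : ℝ) ^ θ) :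
    ∀ g : ℂ → ℂ, Meromorphic g → (∀ s : ℂ, 1 < s.re → g s = partialStandardL S₀ α s) →
      meromorphicOrderAt g (3 / 2) = -1 :=
  fun _g hg hagree =>
    meromorphicOrderAt_eq_neg_one_of_thetaShape_degOne hS₀ hθ hc hα hcard hαθ (hg _) (by norm_num) hagree

end ThetaShape

end Summit.HodgeConjecture.HodgeConjecture.Cruxes.H413.F0P2wPoleOrderJunction

end
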